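import Literature.MathematicalPhysics.QuantumFieldTheory.Balaban1983to89.Node00.OpsYDeltaA
import Literature.MathematicalPhysics.QuantumFieldTheory.Balaban1983to89.B9Thm314WholePinGeometry
import Literature.MathematicalPhysics.QuantumFieldTheory.Balaban1983to89.B9GeoNormsKLevelModelSignsV1
import Literature.MathematicalPhysics.QuantumFieldTheory.Balaban1983to89.B9RecordDELettersVacuity

/-!
# `Balaban1983to89.B9Thm314Thm315RecordVacuity` — ROWS 22–24 OF THE N06 CERTIFICATE AT THE INSTANCE OF RECORD `Node00.opsYOfRecord` (def-Y v2):
# VACUOUS AT THE PIN — the Sect. D∕E letters `Kdiff` (G(Ω, U) − G(Ω′, U)) and `Ck` (C^{(k)}(Λ, U)) of `Node00.lettersYOfRecord` are the flat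
# placeholders `0`, so Theorem 3.14 (both readings) holds OUTRIGHT there and Theorem 3.15 holds modulo its two expansion slots (kernel certificate)

T. Bałaban, *Propagators for lattice gauge theories in a background field*, Commun. Math. Phys. **99** (1985) 389–434
[`Balaban1985BackgroundPropagators`, "B9"].

statement-level skeleton of published theorems with citation tags; proofs where landed; nothing here is a claim about the Yang–Mills mass gap

THE PRINTED LOCI (verbatim).  Theorem 3.14, p. 427: *"If we take a pair of operators constructed for the two sequences {Ω_j}, {Ω′_j}, then their
difference satisfies all the inequalities characteristic for operators of the considered type, with the additional factor exp(−δ₀d(y, y′, Ω))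
…"*; Theorem 3.15, p. 432: *"For Mα₀ sufficiently small the propagator C^{(k)}(Λ) is given by the formula (3.185), and satisfies the bound
|C^{(k)}(Λ; y, y′)| ≤ B₀e^{−δ₀|y−y′|}, y, y′ ∈ Λ (3.187)"*.

THE POINT (a LOCATED finding, not a discharge).  def-Y's instance of record `Node00.opsYOfRecord N θ M⋆ 𝔈 := opsYOfLetters N θ M⋆ (lettersYOfRecord
N θ M⋆) 𝔈` (p484082, `Node00.OpsYDeltaA`) carries GENUINE Sect. A–C letters (transporters, G′(U), Δ_a(U), G(U), C(U)) but — as its §6 says — the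
Sect. D∕E letters `GD, G₁, GG, Kdiff, H, H₁, Ck, QGQinv, QG1Qinv, P349` are still the flat placeholders `0` of `covLettersY_flat`.  Consequently the
certificate binders of rows 22–24 (`…N06AtRecord11CB10YZW.b9_main_of_up_view₁₁B10YZW_of_obligations` :252 `t314`, :257 `t315`, :261 `t314loc`)
at `ops := opsYOfRecord N θ M⋆ 𝔈` speak about the readings of the ZERO letter: all thirteen (3.42)–(3.46) quantities of `(ops x).Kdiff` and the
two-point kernel of `(ops x).Ck` are IDENTICALLY 0, and the printed bounds hold with any positive constants (right-hand sides ≥ 0 by the model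
signs).  THIS FILE is the kernel certificate of that reading (the twin of dag-n06-i's `B9RecordDELettersVacuity` for rows 25–26):
* §1 the zero bond letter reads 0 (`cdB_zero ∕ cdsB_zero ∕ supInB_zero ∕ siteKernelOfOp_zero_ker` CITED from dag-n06-i's
  `B9RecordDELettersVacuity`): `lapB_zero ∕ l2OfY_zero ∕ holderQB_zero`, `kernelFamilyB_zero_e ∕ _l2 ∕ _h1 ∕ _e4 ∕ _h2`;
* §2 the printed leaves from vanishing quantities: `thm314Printed_of_e_zero`, `thm314LocalPrinted_of_zero`, `thm315FullPrinted_of_ker_zero`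
  (the latter modulo the two slot inhabitations «(3.185) holds at U» and «C^{(k)} has the RW expansion at U, rate δ₀»);
* §3 at the record: `lettersYOfRecord_Kdiff ∕ _Ck` (`rfl`), ★ `t314_opsYOfRecord_vacuous`, ★ `t314loc_opsYOfRecord_vacuous` (rows 22–23 OUTRIGHT,
  no hypothesis), ★ `t315_opsYOfRecord_of_slots` (row 24 from the two slots of `𝔈` only).

HONEST SCOPE.  Rows 22–24 are VACUOUS AT THE PIN, not discharged: they become contentful only when a successor of def-Y constructs
G(Ω, U) − G(Ω′, U) (the Ω-restricted propagators of Sect. D∕E) and C^{(k)}(Λ, U) ((3.185)); the non-vacuous routes are the seat's landed faces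
at a generic letter family (`B9Thm314WholePairWalks`, `B9Thm314WholeCancellationLayer`, `B9Thm315WholeBlocks`).  Nothing of print asserted;
count-neutral; N06 NOT discharged; one finite lattice paper; nothing continuum, nothing about the mass gap.  Cell `pub-ymgap` (D-0062), node N06 [B9],
N06-ASSIGNMENT v1 rows 22–24 (successor file of bundle F8), seat `pub-ymgap-dag-n06-m` (g3), 2026-08-27.
-/

noncomputable section

namespace Literature.MathematicalPhysics.QuantumFieldTheory.Balaban1983to89.B9Thm314Thm315RecordVacuity

open Finset
open B9 B9Thm314 B9FromB6ModelSignsOn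
open B9Eq39Adjoint (R R_zero)
open B6GlobalChartV1 (PV blkV1)
open B6KLevelCensusIndexV1 (KIdx)
open B6Ineq2142KLevelV1 (β)
open B9GeoNormsKLevelV1 (geo9K)
open B9GeoNormsKLevelModelSignsV1 (modelSignsOn_geo9K)
open B9PinMembersKLevelV1 (MemberY geo9Y bg9Y)
open B9PinGeometryKLevelV1 (dOmegaY OmKY c35Y inΛY unitDistY)
open B7Prop2SpecialUnitary (specialUnitaryUnits)
open Node00 (FBondY BlkY CfgY BallY BondOpY BondParY liftY cdB cdsB lapB supInB l2OfY holderQB kernelFamilyB siteKernelOfOp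
  Stage3Params ExpsY opsYOfRecord lettersYOfRecord opsYOfLetters operatorLayerYOfLetters)
open B9RecordDELettersVacuity (cdB_zero cdsB_zero supInB_zero siteKernelOfOp_zero_ker)

variable {d ℓ : ℕ} {hd : 1 ≤ d + 1} {hL : Odd (ℓ + 1) ∧ 1 < ℓ + 1} {b₀ b₁ : ℝ}
variable {𝔸 : Type} [NormedRing 𝔸] [NormedAlgebra ℂ 𝔸] [CompleteSpace 𝔸]

/-! ## §1 The zero bond letter reads zero -/

section Zero

variable (i : KIdx d ℓ hd hL b₀ b₁)

/-- Δ_U0 = 0. [cite: Balaban1985BackgroundPropagators, (3.23) p.395, bookkeeping] -/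
theorem lapB_zero (U : CfgY 𝔸 i) : lapB i U (0 : FBondY i → 𝔸) = 0 := by
  funext b
  simp only [lapB, cdB_zero, cdsB_zero, Pi.zero_apply, Finset.sum_const_zero]

omit [NormedAlgebra ℂ 𝔸] [CompleteSpace 𝔸] in
/-- the cut-off L² norm of 0 is 0. [cite: Balaban1985BackgroundPropagators, (3.46) p.398, bookkeeping] -/
theorem l2OfY_zero (h : FBondY i → ℝ) : l2OfY h (0 : FBondY i → 𝔸) = 0 := by
  simp [l2OfY]

omit [CompleteSpace 𝔸] in
/-- the covariant Hölder quotient of 0 is 0. [cite: Balaban1985BackgroundPropagators, (3.40) p.397, bookkeeping] -/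
theorem holderQB_zero (par : Site (PV d ℓ i.m i.K hd hL) 0 → Site (PV d ℓ i.m i.K hd hL) 0 → 𝔸ˣ) (α : ℝ) (ζ : FBondY i → ℝ) :
    holderQB i par α ζ (0 : FBondY i → 𝔸) = 0 := by
  unfold holderQB
  simp only [Pi.zero_apply, smul_zero, R_zero, sub_zero, norm_zero, mul_zero, ite_self, Real.iSup_const_zero]

variable {i} {B : B9.Backgrounds} (cfg : B.Cfg → CfgY 𝔸 i) (par : BondParY 𝔸 i)

/-- **THE (3.42) ENTRIES OF THE ZERO LETTER VANISH**. [cite: Balaban1985BackgroundPropagators, (3.42) p.397, bookkeeping] -/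
theorem kernelFamilyB_zero_e (n : Fin 4) (U : B.Cfg) (lam : (geo9K i).Loc) (y : (geo9K i).Site) :
    (kernelFamilyB i B cfg (fun _ => 0) par).e n U lam y = 0 := by
  rcases lam with f | J
  · rfl
  · fin_cases n
    · show (⨆ E : BallY 𝔸, supInB i (β i.hN i.D i.hk y)
        ((0 : (FBondY i → 𝔸) →ₗ[ℂ] (FBondY i → 𝔸)) (liftY J (E : 𝔸)))) = 0
      simp only [LinearMap.zero_apply, supInB_zero, Real.iSup_const_zero]
    · show (⨆ E : BallY 𝔸, ⨆ ν : Fin (d + 1), supInB i (β i.hN i.D i.hk y)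
        (cdB i (cfg U) ν ((0 : (FBondY i → 𝔸) →ₗ[ℂ] (FBondY i → 𝔸)) (liftY J (E : 𝔸))))) = 0
      simp only [LinearMap.zero_apply, cdB_zero, supInB_zero, Real.iSup_const_zero]
    · show (⨆ E : BallY 𝔸, ⨆ ν : Fin (d + 1), supInB i (β i.hN i.D i.hk y)
        ((0 : (FBondY i → 𝔸) →ₗ[ℂ] (FBondY i → 𝔸)) (cdsB i (cfg U) ν (liftY J (E : 𝔸))))) = 0
      simp only [LinearMap.zero_apply, supInB_zero, Real.iSup_const_zero]
    · show (⨆ E : BallY 𝔸, supInB i (β i.hN i.D i.hk y)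
        (lapB i (cfg U) ((0 : (FBondY i → 𝔸) →ₗ[ℂ] (FBondY i → 𝔸)) (liftY J (E : 𝔸))))) = 0
      simp only [LinearMap.zero_apply, lapB_zero, supInB_zero, Real.iSup_const_zero]

/-- **THE (3.46) LINES OF THE ZERO LETTER VANISH**. [cite: Balaban1985BackgroundPropagators, (3.46) p.398, bookkeeping] -/
theorem kernelFamilyB_zero_l2 (n : Fin 6) (U : B.Cfg) (lam : (geo9K i).Loc) (hh : (geo9K i).Cut) :
    (kernelFamilyB i B cfg (fun _ => 0) par).l2 n U lam hh = 0 := by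
  rcases lam with f | J
  · cases hh <;> rfl
  · rcases hh with z | h
    · rfl
    · fin_cases n
      · show (⨆ E : BallY 𝔸, l2OfY h ((0 : (FBondY i → 𝔸) →ₗ[ℂ] (FBondY i → 𝔸)) (liftY J (E : 𝔸)))) = 0
        simp only [LinearMap.zero_apply, l2OfY_zero, Real.iSup_const_zero]
      · show (⨆ E : BallY 𝔸, ⨆ ν : Fin (d + 1),
          l2OfY h (cdB i (cfg U) ν ((0 : (FBondY i → 𝔸) →ₗ[ℂ] (FBondY i → 𝔸)) (liftY J (E : 𝔸))))) = 0
        simp only [LinearMap.zero_apply, cdB_zero, l2OfY_zero, Real.iSup_const_zero]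
      · show (⨆ E : BallY 𝔸, ⨆ ν : Fin (d + 1),
          l2OfY h ((0 : (FBondY i → 𝔸) →ₗ[ℂ] (FBondY i → 𝔸)) (cdsB i (cfg U) ν (liftY J (E : 𝔸))))) = 0
        simp only [LinearMap.zero_apply, l2OfY_zero, Real.iSup_const_zero]
      · show (⨆ E : BallY 𝔸, ⨆ ν : Fin (d + 1), ⨆ μ : Fin (d + 1),
          l2OfY h (cdB i (cfg U) ν ((0 : (FBondY i → 𝔸) →ₗ[ℂ] (FBondY i → 𝔸)) (cdsB i (cfg U) μ (liftY J (E : 𝔸)))))) = 0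
        simp only [LinearMap.zero_apply, cdB_zero, l2OfY_zero, Real.iSup_const_zero]
      · show (⨆ E : BallY 𝔸, ⨆ ν : Fin (d + 1), ⨆ μ : Fin (d + 1),
          l2OfY h (cdB i (cfg U) ν (cdB i (cfg U) μ ((0 : (FBondY i → 𝔸) →ₗ[ℂ] (FBondY i → 𝔸)) (liftY J (E : 𝔸)))))) = 0
        simp only [LinearMap.zero_apply, cdB_zero, l2OfY_zero, Real.iSup_const_zero]
      · show (⨆ E : BallY 𝔸, ⨆ ν : Fin (d + 1), ⨆ μ : Fin (d + 1),
          l2OfY h ((0 : (FBondY i → 𝔸) →ₗ[ℂ] (FBondY i → 𝔸)) (cdsB i (cfg U) ν (cdsB i (cfg U) μ (liftY J (E : 𝔸)))))) = 0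
        simp only [LinearMap.zero_apply, l2OfY_zero, Real.iSup_const_zero]

/-- **THE (3.43) ENTRY OF THE ZERO LETTER VANISHES**. [cite: Balaban1985BackgroundPropagators, (3.43) p.398, bookkeeping] -/
theorem kernelFamilyB_zero_h1 (U : B.Cfg) (lam : (geo9K i).Loc) (α : ℝ) (ζ : (geo9K i).Cut) :
    (kernelFamilyB i B cfg (fun _ => 0) par).h1 U lam α ζ = 0 := by
  rcases lam with f | J
  · cases ζ <;> rfl
  · rcases ζ with z | z
    · rfl
    · show (⨆ E : BallY 𝔸,
        max (⨆ ν : Fin (d + 1), holderQB i (par (cfg U)) α z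
          (cdB i (cfg U) ν ((0 : (FBondY i → 𝔸) →ₗ[ℂ] (FBondY i → 𝔸)) (liftY J (E : 𝔸)))))
          (⨆ ν : Fin (d + 1), holderQB i (par (cfg U)) α z
            ((0 : (FBondY i → 𝔸) →ₗ[ℂ] (FBondY i → 𝔸)) (cdsB i (cfg U) ν (liftY J (E : 𝔸)))))) = 0
      simp only [LinearMap.zero_apply, cdB_zero, holderQB_zero, Real.iSup_const_zero, max_self]

/-- **THE (3.44) ENTRY OF THE ZERO LETTER VANISHES**. [cite: Balaban1985BackgroundPropagators, (3.44) p.398, bookkeeping] -/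
theorem kernelFamilyB_zero_e4 (U : B.Cfg) (lam : (geo9K i).Loc) (y : (geo9K i).Site) :
    (kernelFamilyB i B cfg (fun _ => 0) par).e4 U lam y = 0 := by
  rcases lam with f | J
  · rfl
  · show (⨆ E : BallY 𝔸, ⨆ ν : Fin (d + 1), ⨆ μ : Fin (d + 1), supInB i (β i.hN i.D i.hk y)
      (cdB i (cfg U) ν ((0 : (FBondY i → 𝔸) →ₗ[ℂ] (FBondY i → 𝔸)) (cdsB i (cfg U) μ (liftY J (E : 𝔸)))))) = 0
    simp only [LinearMap.zero_apply, cdB_zero, supInB_zero, Real.iSup_const_zero]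

/-- **THE (3.45) ENTRY OF THE ZERO LETTER VANISHES**. [cite: Balaban1985BackgroundPropagators, (3.45) p.398, bookkeeping] -/
theorem kernelFamilyB_zero_h2 (U : B.Cfg) (lam : (geo9K i).Loc) (α : ℝ) (ζ : (geo9K i).Cut) :
    (kernelFamilyB i B cfg (fun _ => 0) par).h2 U lam α ζ = 0 := by
  rcases lam with f | J
  · cases ζ <;> rfl
  · rcases ζ with z | z
    · rfl
    · show (⨆ E : BallY 𝔸, ⨆ ν : Fin (d + 1), ⨆ μ : Fin (d + 1), holderQB i (par (cfg U)) α z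
        (cdB i (cfg U) ν ((0 : (FBondY i → 𝔸) →ₗ[ℂ] (FBondY i → 𝔸)) (cdsB i (cfg U) μ (liftY J (E : 𝔸)))))) = 0
      simp only [LinearMap.zero_apply, cdB_zero, holderQB_zero, Real.iSup_const_zero]

end Zero

/-! ## §2 The printed leaves from vanishing readings -/

section Leaves

variable {I : Type} {c35 : ℝ} {geo : I → Geometry} {bg : I → Backgrounds} {Ps : ∀ i, (geo i).Loc → Prop}

/-- the scale length is nonnegative under the model signs. [cite: Balaban1985BackgroundPropagators, (3.41) p.397, bookkeeping] -/
private theorem len_nonneg (S : ∀ i, ModelSignsOn (geo i) (Ps i)) (i : I) (y : (geo i).Site) : 0 ≤ (geo i).len y :=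
  mul_nonneg (pow_nonneg (S i).L_nonneg _) (S i).eta_nonneg

/-- **THEOREM 3.14 (leaf reading) FOR A FAMILY WHOSE (3.42) ENTRIES VANISH** — with constants 1, the right-hand sides being nonnegative under the
model signs. [cite: Balaban1985BackgroundPropagators, Thm 3.14 (3.154) pp.426–427] -/
theorem thm314Printed_of_e_zero (Kdiff : ∀ i, KernelFamily (geo i) (bg i)) (dOmega : ∀ i, (geo i).Site → (geo i).Site → ℝ)
    (S : ∀ i, ModelSignsOn (geo i) (Ps i)) (hK : ∀ i n U lam y, (Kdiff i).e n U lam y = 0) :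
    Thm314Printed c35 geo bg Kdiff dOmega := by
  refine ⟨1, 1, 1, 1, one_pos, one_pos, one_pos, one_pos, fun i _ α₀ _ _ U _ n lam y y' _ => ?_⟩
  rw [hK]
  exact mul_nonneg (mul_nonneg (mul_nonneg (mul_nonneg zero_le_one (B9FromB6.pref4_nonneg (len_nonneg S i y) n))
    (Real.exp_nonneg _)) (Real.exp_nonneg _)) ((S i).supNorm_nonneg lam)

/-- **THEOREM 3.14 (local reading, all thirteen quantities) FOR A FAMILY WHOSE QUANTITIES VANISH** — with constants 1.
[cite: Balaban1985BackgroundPropagators, Thm 3.14 (3.154) pp.426–427] -/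
theorem thm314LocalPrinted_of_zero (Kdiff : ∀ i, KernelFamily (geo i) (bg i)) (OmK : ∀ i, (geo i).Site → Prop)
    (dOmega : ∀ i, (geo i).Site → (geo i).Site → ℝ) (S : ∀ i, ModelSignsOn (geo i) (Ps i))
    (he : ∀ i n U lam y, (Kdiff i).e n U lam y = 0) (hl2 : ∀ i n U lam h, (Kdiff i).l2 n U lam h = 0)
    (hh1 : ∀ i U lam α ζ, (Kdiff i).h1 U lam α ζ = 0) (he4 : ∀ i U lam y, (Kdiff i).e4 U lam y = 0)
    (hh2 : ∀ i U lam α ζ, (Kdiff i).h2 U lam α ζ = 0) :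
    Thm314LocalPrinted c35 geo bg Kdiff OmK dOmega := by
  refine ⟨1, 1, 1, 1, fun _ => 1, fun _ => 1, fun _ _ => 1, one_pos, one_pos, one_pos, one_pos,
    fun i _ α₀ _ _ U _ => ⟨fun n lam y y' _ _ _ => ?_, fun n lam h y y' _ _ _ _ => ?_, ⟨fun β lam ζ y y' _ _ _ _ _ _ => ?_,
      fun ε lam y y' _ _ _ _ _ => ?_, fun ε β lam ζ y y' _ _ _ _ _ _ _ _ => ?_⟩⟩⟩
  · rw [he]
    exact mul_nonneg (mul_nonneg (mul_nonneg (mul_nonneg zero_le_one (B9FromB6.pref4_nonneg (len_nonneg S i y) n))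
      (Real.exp_nonneg _)) (Real.exp_nonneg _)) ((S i).supNorm_nonneg lam)
  · rw [hl2]
    exact mul_nonneg (mul_nonneg (mul_nonneg (mul_nonneg (mul_nonneg zero_le_one (B9FromB6.pref6_nonneg (len_nonneg S i y) n))
      ((S i).cutSup_nonneg h)) (Real.exp_nonneg _)) (Real.exp_nonneg _)) ((S i).l2Norm_nonneg lam)
  · rw [hh1]
    exact mul_nonneg (mul_nonneg (mul_nonneg (mul_nonneg (mul_nonneg zero_le_one (Real.rpow_nonneg (len_nonneg S i y) _))
      ((S i).cutH_nonneg β ζ)) (Real.exp_nonneg _)) (Real.exp_nonneg _)) ((S i).supNorm_nonneg lam)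
  · rw [he4]
    exact mul_nonneg (mul_nonneg (mul_nonneg zero_le_one (Real.exp_nonneg _)) (Real.exp_nonneg _))
      (add_nonneg ((S i).holder_nonneg ε lam) ((S i).supNorm_nonneg lam))
  · rw [hh2]
    exact mul_nonneg (mul_nonneg (mul_nonneg (mul_nonneg (mul_nonneg zero_le_one (Real.rpow_nonneg (len_nonneg S i y) _))
      ((S i).cutH_nonneg β ζ)) (Real.exp_nonneg _)) (Real.exp_nonneg _))
      (add_nonneg ((S i).holder_nonneg (β + ε) lam) ((S i).supNorm_nonneg lam))

/-- **THEOREM 3.15 (whole leaf) FOR A FAMILY WHOSE KERNEL READING VANISHES**, modulo the two slot inhabitations: «(3.185) holds at U» and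
«C^{(k)}(Λ) has the convergent random walk expansion at U with rate δ₀» (the free predicate fields of the expansion letters).
[cite: Balaban1985BackgroundPropagators, Thm 3.15 (3.185)–(3.187) p.432] -/
theorem thm315FullPrinted_of_ker_zero (Ck : ∀ i, SiteKernel (geo i) (bg i)) (inΛ : ∀ i, (geo i).Site → Prop)
    (unitDist : ∀ i, (geo i).Site → (geo i).Site → ℝ) (GivenBy3185 : ∀ i, (bg i).Cfg → Prop) (HasRWExpC : ∀ i, (bg i).Cfg → ℝ → Prop)
    (hK : ∀ i U y y', (Ck i).ker U y y' = 0) {δ₀ : ℝ} (hδ₀ : 0 < δ₀) (hG : ∀ i U, GivenBy3185 i U) (hH : ∀ i U, HasRWExpC i U δ₀) :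
    Thm315FullPrinted c35 geo bg Ck inΛ unitDist GivenBy3185 HasRWExpC :=
  ⟨δ₀, 1, 1, hδ₀, one_pos, one_pos, fun i _ _ _ U _ _ => ⟨hG i U, hH i U, fun y y' _ _ => by
    rw [hK, abs_zero]
    exact mul_nonneg zero_le_one (Real.exp_nonneg _)⟩⟩

end Leaves

/-! ## §3 At the instance of record -/

section Record

open scoped Matrix.Norms.L2Operator

variable (N : ℕ) (θ : Stage3Params) (Mstar : ℕ)

/-- the letter G(Ω, U) − G(Ω′, U) of record is the flat placeholder 0. [cite: Balaban1985BackgroundPropagators, Thm 3.14 p.427 (the letter), bookkeeping] -/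
theorem lettersYOfRecord_Kdiff (x : MemberY θ.d₆ θ.ℓ₆ θ.hd' θ.hL' θ.b₀ θ.b₁ Mstar) : (lettersYOfRecord N θ Mstar x).Kdiff = fun _ => 0 := rfl

/-- the letter C^{(k)}(Λ, U) of record is the flat placeholder 0. [cite: Balaban1985BackgroundPropagators, Thm 3.15 (3.185) p.432 (the letter), bookkeeping] -/
theorem lettersYOfRecord_Ck (x : MemberY θ.d₆ θ.ℓ₆ θ.hd' θ.hL' θ.b₀ θ.b₁ Mstar) : (lettersYOfRecord N θ Mstar x).Ck = fun _ => 0 := rfl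

/-- the `Kdiff` family of record IS the reading of the zero letter. [cite: Balaban1985BackgroundPropagators, Thm 3.14 p.427, bookkeeping] -/
theorem opsYOfRecord_Kdiff (𝔈 : ExpsY N θ Mstar) (x : MemberY θ.d₆ θ.ℓ₆ θ.hd' θ.hL' θ.b₀ θ.b₁ Mstar) :
    ((opsYOfRecord N θ Mstar 𝔈) x).Kdiff =
      kernelFamilyB x.toKIdx (bg9Y (Matrix (Fin N) (Fin N) ℂ) (specialUnitaryUnits (Fin N)) x) (fun U => U) (fun _ => 0)
        (lettersYOfRecord N θ Mstar x).parB := rfl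

/-- the `Ck` kernel of record IS the reading of the zero letter. [cite: Balaban1985BackgroundPropagators, Thm 3.15 (3.187) p.432, bookkeeping] -/
theorem opsYOfRecord_Ck (𝔈 : ExpsY N θ Mstar) (x : MemberY θ.d₆ θ.ℓ₆ θ.hd' θ.hL' θ.b₀ θ.b₁ Mstar) :
    ((opsYOfRecord N θ Mstar 𝔈) x).Ck =
      siteKernelOfOp x.toKIdx (bg9Y (Matrix (Fin N) (Fin N) ℂ) (specialUnitaryUnits (Fin N)) x) (fun U => U)
        (fun _ => (0 : (BlkY x.toKIdx → Matrix (Fin N) (Fin N) ℂ) →ₗ[ℂ] (BlkY x.toKIdx → Matrix (Fin N) (Fin N) ℂ)))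
        (β x.hN x.D x.hk) (β x.hN x.D x.hk) := rfl

/-- ★ **ROW 22 (`t314`) AT THE INSTANCE OF RECORD HOLDS OUTRIGHT — VACUOUSLY** (the letter is the placeholder 0).
[cite: Balaban1985BackgroundPropagators, Thm 3.14 (3.154) pp.426–427] -/
theorem t314_opsYOfRecord_vacuous (𝔈 : ExpsY N θ Mstar) :
    B9.Thm314Printed c35Y geo9Y (bg9Y (Matrix (Fin N) (Fin N) ℂ) (specialUnitaryUnits (Fin N)))
      (fun x => ((opsYOfRecord N θ Mstar 𝔈) x).Kdiff) dOmegaY :=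
  thm314Printed_of_e_zero _ _ (fun x => modelSignsOn_geo9K x.toKIdx)
    fun x n U lam y => by rw [opsYOfRecord_Kdiff]; exact kernelFamilyB_zero_e _ _ n U lam y

/-- ★ **ROW 23 (`t314loc`) AT THE INSTANCE OF RECORD HOLDS OUTRIGHT — VACUOUSLY**. [cite: Balaban1985BackgroundPropagators, Thm 3.14 (3.154) pp.426–427] -/
theorem t314loc_opsYOfRecord_vacuous (𝔈 : ExpsY N θ Mstar) :
    B9Thm314.Thm314LocalPrinted c35Y geo9Y (bg9Y (Matrix (Fin N) (Fin N) ℂ) (specialUnitaryUnits (Fin N)))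
      (fun x => ((opsYOfRecord N θ Mstar 𝔈) x).Kdiff) OmKY dOmegaY :=
  thm314LocalPrinted_of_zero _ _ _ (fun x => modelSignsOn_geo9K x.toKIdx)
    (fun x n U lam y => by rw [opsYOfRecord_Kdiff]; exact kernelFamilyB_zero_e _ _ n U lam y)
    (fun x n U lam h => by rw [opsYOfRecord_Kdiff]; exact kernelFamilyB_zero_l2 _ _ n U lam h)
    (fun x U lam α ζ => by rw [opsYOfRecord_Kdiff]; exact kernelFamilyB_zero_h1 _ _ U lam α ζ)
    (fun x U lam y => by rw [opsYOfRecord_Kdiff]; exact kernelFamilyB_zero_e4 _ _ U lam y)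
    (fun x U lam α ζ => by rw [opsYOfRecord_Kdiff]; exact kernelFamilyB_zero_h2 _ _ U lam α ζ)

/-- ★ **ROW 24 (`t315`) AT THE INSTANCE OF RECORD FROM THE TWO SLOTS OF `𝔈` ONLY**: the bound (3.187) is vacuous (the letter is the
placeholder 0); displayed: «(3.185) holds at U» and «C^{(k)} has the RW expansion at U, rate δ₀» as the free predicate fields of the expansion
letters `𝔈` (inhabited by the choice of `𝔈`). [cite: Balaban1985BackgroundPropagators, Thm 3.15 (3.185)–(3.187) p.432] -/
theorem t315_opsYOfRecord_of_slots (𝔈 : ExpsY N θ Mstar) {δ₀ : ℝ} (hδ₀ : 0 < δ₀)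
    (hG : ∀ (x : MemberY θ.d₆ θ.ℓ₆ θ.hd' θ.hL' θ.b₀ θ.b₁ Mstar) (U : (bg9Y (Matrix (Fin N) (Fin N) ℂ) (specialUnitaryUnits (Fin N)) x).Cfg),
      ((opsYOfRecord N θ Mstar 𝔈) x).GivenBy3185 U)
    (hH : ∀ (x : MemberY θ.d₆ θ.ℓ₆ θ.hd' θ.hL' θ.b₀ θ.b₁ Mstar) (U : (bg9Y (Matrix (Fin N) (Fin N) ℂ) (specialUnitaryUnits (Fin N)) x).Cfg),
      ((opsYOfRecord N θ Mstar 𝔈) x).HasRWExpC U δ₀) :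
    B9.Thm315FullPrinted c35Y geo9Y (bg9Y (Matrix (Fin N) (Fin N) ℂ) (specialUnitaryUnits (Fin N)))
      (fun x => ((opsYOfRecord N θ Mstar 𝔈) x).Ck) inΛY unitDistY (fun x => ((opsYOfRecord N θ Mstar 𝔈) x).GivenBy3185)
      (fun x => ((opsYOfRecord N θ Mstar 𝔈) x).HasRWExpC) :=
  thm315FullPrinted_of_ker_zero _ _ _ _ _ (fun x U y y' => by rw [opsYOfRecord_Ck]; exact siteKernelOfOp_zero_ker _ _ _ _ _ U y y')
    hδ₀ hG hH

end Record

end Literature.MathematicalPhysics.QuantumFieldTheory.Balaban1983to89.B9Thm314Thm315RecordVacuity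

end
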